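import Summits.Ventures.QEC.Census.CertCoverBatch
import Summits.Ventures.QEC.Census.BB.A1s_n192_k8_4a6ca3c0.CoreDefs
import HarnessLib

set_option Elab.async false
set_option maxRecDepth 200000

/-!
# `[[192,8,16]]` one-level cover certificate of `A1s_n192_k8_4a6ca3c0` — LEVEL-1→0 coset problems 214…241 (deep problems [2] excluded: `ProbDeep*.lean`) as COMPACT data
(`ProbData`: U, f, σ, y₀, allow; qec-type-10 `CertCoverBatch.mkCoset` rebuilds each `CosetProb` in the kernel) + their verdict
`probsOK cov covR hx hx1 D1 lxd 14` (one `decide +kernel`; 28 problems, depths f=0:25 f=1:3 f=2:0 f=3:0, est. 111.5 s).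
qec-search-1 g5 (pattern of search-9 g5 `Probs*`); data from JSON `level10.problems` (sha256 9a88e3f709803792…). Data + decided check; KERNEL.
-/

namespace Summit.Ventures.QEC.Census.A1s_n192_k8_4a6ca3c0

open Matrix Summit.Ventures.QEC.Census Literature.InformationTheory.QuantumCodes

/-- Problems 214…241 (28): `⟨U, f, σ, y₀, allow⟩`. -/
def probs05a : List ProbData := [
    ⟨5445037309770295603626376, 0, 77848379667, 4835703288591618846753160, []⟩,
    ⟨5445037363118599216037890, 0, 77898712077, 5440166188696840031961151, []⟩,
    ⟨5445040822578036594467588, 0, 77848463001, 4874552121586196940196, []⟩,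
    ⟨5445792454220322319651328, 0, 77859227777, 4740813240769796274356, []⟩,
    ⟨5454482043861934768390528, 0, 77982597411, 609334021178677293744136, []⟩,
    ⟨5596153055236522223075593, 0, 80012640789, 609334048200274974081083, []⟩,
    ⟨5605597789328161387839745, 0, 80146858533, 4996263741127886782857522, []⟩,
    ⟨5747121749730683578224644, 0, 82174828633, 906694373718171135774724, [0]⟩,
    ⟨5747272340532088688107808, 0, 82176985600, 911569060947745432405086, []⟩,
    ⟨6049500201563215942910408, 0, 86639640593, 4835703288591623108166024, []⟩,
    ⟨9676132383853301100716100, 1, 138579853720, 9671410015681581577928708, [0]⟩,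
    ⟨9676136130848157250110596, 0, 138579907384, 9676136130848225432699904, []⟩,
    ⟨9676277659712239770271750, 0, 138632232965, 9671406557348044693570511, []⟩,
    ⟨9676281119171612724192000, 1, 138581983889, 4874552121552105637792, []⟩,
    ⟨9676296107151307904774144, 0, 138582165521, 4889540101524311512992, []⟩,
    ⟨9676426685662258311726080, 0, 138584002563, 5019838263054367721374, []⟩,
    ⟨9678493568787983822233672, 0, 138580115891, 2361183241434864558152, []⟩,
    ⟨9685871417502097660707848, 0, 138718220339, 9680851579239054200275870, []⟩,
    ⟨9687938298376023424639040, 1, 138714333571, 9685577115134588560080896, [0]⟩,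
    ⟨9687942045370879574033536, 0, 138714387235, 9685580862129512892072960, []⟩,
    ⟨9713911341647140500283392, 0, 139116724232, 268443652, []⟩,
    ⟨9751838991904726042305344, 0, 137508242193, 9671406558043009624073438, []⟩,
    ⟨9763496189123535772327936, 0, 137640591363, 14167099453006982160384, [0]⟩,
    ⟨9789469178351457319526464, 0, 138042982792, 9671410015681581846364164, []⟩,
    ⟨9789617913669768406131460, 0, 138045112961, 9784743361548364745303204, []⟩,
    ⟨9978362190439512208314368, 0, 142908351569, 9973639822267760221618724, []⟩,
    ⟨10280744245151707277844740, 0, 147104812681, 4874696236738839316036, []⟩,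
    ⟨10280889433339986280185928, 0, 147106826545, 5019964363838968037386, []⟩]

set_option maxHeartbeats 400000000 in
/-- Every problem of this chunk passes (`mkCoset` elimination + `cosetOKD` + fast `σ` + depth + `BU`-evenness + label checks). -/
theorem probs05a_ok : probsOK A1s_n192_k8_4a6ca3c0.cov covR hx hx1 D1 lxd 14 probs05a = true := by
  decide +kernel

/-- Pointwise form. -/
theorem probs05a_all : ∀ x ∈ probs05a, probOK A1s_n192_k8_4a6ca3c0.cov covR hx hx1 D1 lxd 14 x = true := by
  have h := probs05a_ok
  rwa [probsOK, List.all_eq_true] at h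

end Summit.Ventures.QEC.Census.A1s_n192_k8_4a6ca3c0
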